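import Summits.Ventures.LatticeQCDFlow.Scaling.LumpedCycleCompositionLaw

/-!
HONEST FRAMING: exact (Metropolis-corrected) sampling algorithms for lattice gauge theory; figures
of merit are autocorrelation/cost numbers at stated couplings and volumes; no continuum-physics
claim.

# LumpedCycleAnyCoupling — THE REFRESH-CYCLE CHAIN OF THE LUMPED STAR WITH AN ARBITRARY MARKOVIAN CHOICE OF END-HUB COUPLINGS: `Q` IS A MARKOVIAN COUPLING, THE
# PRODUCT POTENTIAL'S ONE-STEP IMAGE, AND `d(n) ≤ Ψ_max·(1−ρ)ⁿ` FROM THE EQUAL-HUB CRITERION (lean-2 GEN-36, ours)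

Venture-side (OURS).  Cell `lqcd-flow` (pub-lqcd), unit `pub-lqcd-lean-2-g36`, 2026-08-29.  Chapter W (item 1 (i) at finite swap odds), file 2.  `Scaling/LumpedCycleCompositionLaw`
(chapter V, file 9) built the cycle chain `P(x,x') = Σ_a u_x(a)·μ_0(hub x')·𝟙{comp x' + δ_a = comp x + δ_(hub x')}` of the lumped star with arbitrary end-hub laws `u_x` and coupled
two copies by the OPTIMAL (LPW 4.7) coupling of `(u_x, u_y)` with a shared fresh hub.  At finite swap odds the end-hub laws are geometric resolvents of the one-copy hub chains
(`Scaling/ResolventLaw`), and the couplings one can actually estimate are not the optimal one but those produced by a Markovian coupling of the two hub chains inside the cycle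
(a resolvent on the product space), or the mixture `(1−σ)δ_(z,z) + σ·q̃` of a coupling of the tail laws.  This file is file 9 VERBATIM with the optimal coupling replaced by an
ARBITRARY family `q_{xy}` of couplings of `(u_x, u_y)` (`hqc : IsCoupling (u x) (u y) (q x y)`, tree): `Q` is a Markovian coupling of `P`; for
`Ψ(x,y) = Δ(comp x, comp y)·F(x,y) + C·𝟙{hub x ≠ hub y}`, `F(x,y) = c + s(hub x) + s(hub y) + Σ_v r_v(comp x + comp y)(v)`,
`(Q·Ψ)(x,y) = Σ_{a,b} q_{xy}(a,b)·Δ(M^a_x,M^b_y)·(F + e_{xy} − r_a − r_b)`; the equal-hub criterion for the `q_{xy}` plus a bound `B ≤ (1−ρ)C` give `Q·Ψ ≤ (1−ρ)Ψ` and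
`d(n) ≤ ((K+1)F_max + C)(1−ρ)ⁿ`.  The target-uniqueness, survivor and row-stochasticity lemmas of file 9 are imported, not restated.  Hypothesis-equations, no definitions.

## What is proved

* **`lumpedAny_isMarkovianCoupling`**, **`lumpedAny_mulVec_potential`**, **`lumpedAny_contract`**, **`lumpedAny_worstTvDist_le`** — the four statements of file 9 §1–§2 for any
  coupling family `q`.

Reading (no numerics implied): with `q_{xy}` the law of the pair of end hubs under a Markovian coupling of the two hub chains stopped at the common geometric time, the criterion
`hcrit` is a linear functional of a resolvent on `S × S` and is bounded by the super-solution principle of `Scaling/ResolventLaw`; with `q = (1−σ)δ_(z,z) + σq̃` it is the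
reduction of MEMO-gen35 §7.  NOT CLAIMED: any criterion.  Literature grade (cell rule): OWN, elementary on the tree's LPW files; nothing cited as a fact; no new bib keys.
-/

open Finset Matrix
open Literature.Probability.MarkovChains

namespace Summit.Ventures.LatticeQCDFlow.Scaling

section LumpedAny
variable {X : Type*} [Fintype X] [DecidableEq X] {S : Type*} [Fintype S] [DecidableEq S]
variable {hub : X → S} {comp : X → S → ℕ} {K : ℕ} {μ0 r s : S → ℝ} {c C ρ Fmax : ℝ} {u : X → S → ℝ} {q : X → X → S → S → ℝ}
variable {P : X → X → ℝ} {Q : Matrix (X × X) (X × X) ℝ} {Δ : (S → ℕ) → (S → ℕ) → ℕ} {F : X × X → ℝ} {Ψ : X × X → ℝ}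

omit [DecidableEq X] in
/-- **`Q` is a Markovian coupling of `P`** (end hubs coupled by any couplings `q_{xy}` of `(u_x,u_y)`, fresh hub shared). [ours] -/
theorem lumpedAny_isMarkovianCoupling (hinj : ∀ x x', hub x = hub x' → comp x = comp x' → x = x') (hsum : ∀ x, ∑ v, comp x v = K + 1)
    (hsurj : ∀ (z : S) (N : S → ℕ), ∑ v, N v = K + 1 → N z ≠ 0 → ∃ x, hub x = z ∧ comp x = N)
    (hμ0 : ∀ v, 0 ≤ μ0 v) (hlegal : ∀ x a, u x a ≠ 0 → comp x a ≠ 0)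
    (hqc : ∀ x y, IsCoupling (u x) (u y) (q x y))
    (hP : ∀ x x', P x x' = ∑ a, u x a * (μ0 (hub x') * (if comp x' + Pi.single a 1 = comp x + Pi.single (hub x') 1 then (1 : ℝ) else 0)))
    (hQ : ∀ x y x' y', Q (x, y) (x', y') = ∑ a, ∑ b, q x y a b * (μ0 (hub x')
      * (if comp x' + Pi.single a 1 = comp x + Pi.single (hub x') 1 then (1 : ℝ) else 0))
      * ((if hub y' = hub x' then (1 : ℝ) else 0) * (if comp y' + Pi.single b 1 = comp y + Pi.single (hub y') 1 then (1 : ℝ) else 0))) :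
    IsMarkovianCoupling P Q := by
  intro x y
  have hq := hqc x y
  refine ⟨fun x' y' => ?_, fun x' => ?_, fun y' => ?_⟩
  · show 0 ≤ Q (x, y) (x', y')
    rw [hQ]
    exact sum_nonneg fun a _ => sum_nonneg fun b _ => mul_nonneg (mul_nonneg (hq.1 a b) (mul_nonneg (hμ0 _) (by split_ifs <;> norm_num)))
      (mul_nonneg (by split_ifs <;> norm_num) (by split_ifs <;> norm_num))
  · -- first marginal (sum over `y'`): the `y'`-factor sums to one for legal `b`
    show ∑ y', Q (x, y) (x', y') = P x x'
    simp_rw [hQ]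
    rw [Finset.sum_comm, hP]
    refine sum_congr rfl fun a _ => ?_
    rw [Finset.sum_comm]
    have hb : ∀ b, ∑ y', q x y a b * (μ0 (hub x') * (if comp x' + Pi.single a 1 = comp x + Pi.single (hub x') 1 then (1 : ℝ) else 0))
        * ((if hub y' = hub x' then (1 : ℝ) else 0) * (if comp y' + Pi.single b 1 = comp y + Pi.single (hub y') 1 then (1 : ℝ) else 0))
        = q x y a b * (μ0 (hub x') * (if comp x' + Pi.single a 1 = comp x + Pi.single (hub x') 1 then (1 : ℝ) else 0)) := by
      intro b
      by_cases hqz : q x y a b = 0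
      · simp [hqz]
      · rw [← Finset.mul_sum]
        have hM := lumped_survivor hlegal (urnChain_support hq hqz).2
        -- `Σ_{y'} 𝟙{hub y' = hub x'}𝟙{comp y' = M + δ_(hub y')} = 1`: use `lumped_target_unique` with `μ0 := 𝟙{· = hub x'}`
        have h' : ∑ y', (if hub y' = hub x' then (1 : ℝ) else 0) * (if comp y' + Pi.single b 1 = comp y + Pi.single (hub y') 1 then (1 : ℝ) else 0) = 1 := by
          rw [lumped_target_unique (μ0 := fun z => if z = hub x' then (1 : ℝ) else 0) hinj hsum hsurj hM (fun _ _ => (1 : ℝ))]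
          simp
        rw [h', mul_one]
    simp_rw [hb]
    rw [← Finset.sum_mul, hq.2.1 a]
  · -- second marginal (sum over `x'`)
    show ∑ x', Q (x, y) (x', y') = P y y'
    simp_rw [hQ]
    rw [Finset.sum_comm, hP]
    -- reorder to `Σ_b Σ_a Σ_{x'}`
    rw [show (∑ a, ∑ x', ∑ b, q x y a b * (μ0 (hub x') * (if comp x' + Pi.single a 1 = comp x + Pi.single (hub x') 1 then (1 : ℝ) else 0))
        * ((if hub y' = hub x' then (1 : ℝ) else 0) * (if comp y' + Pi.single b 1 = comp y + Pi.single (hub y') 1 then (1 : ℝ) else 0)))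
        = ∑ b, ∑ a, ∑ x', q x y a b * (μ0 (hub x') * (if comp x' + Pi.single a 1 = comp x + Pi.single (hub x') 1 then (1 : ℝ) else 0))
        * ((if hub y' = hub x' then (1 : ℝ) else 0) * (if comp y' + Pi.single b 1 = comp y + Pi.single (hub y') 1 then (1 : ℝ) else 0)) by
      calc _ = ∑ a, ∑ b, ∑ x', q x y a b * (μ0 (hub x') * (if comp x' + Pi.single a 1 = comp x + Pi.single (hub x') 1 then (1 : ℝ) else 0))
              * ((if hub y' = hub x' then (1 : ℝ) else 0) * (if comp y' + Pi.single b 1 = comp y + Pi.single (hub y') 1 then (1 : ℝ) else 0)) :=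
            sum_congr rfl fun a _ => Finset.sum_comm
        _ = _ := Finset.sum_comm]
    refine sum_congr rfl fun b _ => ?_
    have ha : ∀ a, ∑ x', q x y a b * (μ0 (hub x') * (if comp x' + Pi.single a 1 = comp x + Pi.single (hub x') 1 then (1 : ℝ) else 0))
        * ((if hub y' = hub x' then (1 : ℝ) else 0) * (if comp y' + Pi.single b 1 = comp y + Pi.single (hub y') 1 then (1 : ℝ) else 0))
        = q x y a b * (μ0 (hub y') * (if comp y' + Pi.single b 1 = comp y + Pi.single (hub y') 1 then (1 : ℝ) else 0)) := by
      intro a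
      by_cases hqz : q x y a b = 0
      · simp [hqz]
      · have hM := lumped_survivor hlegal (urnChain_support hq hqz).1
        -- `Σ_{x'} μ0(hub x')𝟙{x'-cond}𝟙{hub y' = hub x'} = μ0(hub y')`
        have h := lumped_target_unique (μ0 := μ0) hinj hsum hsurj hM (fun z _ => if hub y' = z then (1 : ℝ) else 0)
        have hR : ∑ z, μ0 z * (if hub y' = z then (1 : ℝ) else 0) = μ0 (hub y') := by
          simp_rw [mul_ite, mul_one, mul_zero]; rw [Finset.sum_ite_eq]; simp
        rw [hR] at h
        have hrw : ∀ x', q x y a b * (μ0 (hub x') * (if comp x' + Pi.single a 1 = comp x + Pi.single (hub x') 1 then (1 : ℝ) else 0))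
            * ((if hub y' = hub x' then (1 : ℝ) else 0) * (if comp y' + Pi.single b 1 = comp y + Pi.single (hub y') 1 then (1 : ℝ) else 0))
            = (q x y a b * (if comp y' + Pi.single b 1 = comp y + Pi.single (hub y') 1 then (1 : ℝ) else 0))
              * (μ0 (hub x') * (if comp x' + Pi.single a 1 = comp x + Pi.single (hub x') 1 then (if hub y' = hub x' then (1 : ℝ) else 0) else 0)) := by
          intro x'; split_ifs <;> ring
        simp_rw [hrw]
        rw [← Finset.mul_sum, h]
        ring
    simp_rw [ha]
    rw [← Finset.sum_mul, hq.2.2 b]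

/-! ## §2 The potential with a hub-disagreement term, and the law -/

omit [DecidableEq X] in
/-- **`(Q·Ψ)(x,y)` in end-hub form.**  With `Ψ(x,y) = Δ(comp x, comp y)·F(x,y) + C·𝟙{hub x ≠ hub y}`,
`F(x,y) = c + s(hub x) + s(hub y) + Σ_v r_v(comp x v + comp y v)`:
`(Q·Ψ)(x,y) = Σ_{a,b} q_{xy}(a,b)·Δ(M^a_x, M^b_y)·(F(x,y) + e_{xy} − r_a − r_b)`, `e_{xy} = 2Σμ_0 s − s(hub x) − s(hub y) + 2Σ μ_0 r`. [ours] -/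
theorem lumpedAny_mulVec_potential (hinj : ∀ x x', hub x = hub x' → comp x = comp x' → x = x') (hsum : ∀ x, ∑ v, comp x v = K + 1)
    (hsurj : ∀ (z : S) (N : S → ℕ), ∑ v, N v = K + 1 → N z ≠ 0 → ∃ x, hub x = z ∧ comp x = N)
    (hμ1 : ∑ v, μ0 v = 1) (hlegal : ∀ x a, u x a ≠ 0 → comp x a ≠ 0)
    (hqc : ∀ x y, IsCoupling (u x) (u y) (q x y))
    (hΔ : ∀ N N', Δ N N' = ∑ v, (N v - N' v))
    (hQ : ∀ x y x' y', Q (x, y) (x', y') = ∑ a, ∑ b, q x y a b * (μ0 (hub x')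
      * (if comp x' + Pi.single a 1 = comp x + Pi.single (hub x') 1 then (1 : ℝ) else 0))
      * ((if hub y' = hub x' then (1 : ℝ) else 0) * (if comp y' + Pi.single b 1 = comp y + Pi.single (hub y') 1 then (1 : ℝ) else 0)))
    (hF : ∀ x y, F (x, y) = c + s (hub x) + s (hub y) + ∑ v, r v * ((comp x v : ℝ) + (comp y v : ℝ)))
    (hΨ : ∀ x y, Ψ (x, y) = (Δ (comp x) (comp y) : ℝ) * F (x, y) + C * (if hub x = hub y then (0 : ℝ) else 1)) (x y : X) :
    (Q *ᵥ Ψ) (x, y) = ∑ a, ∑ b, q x y a b * ((Δ (comp x - Pi.single a 1) (comp y - Pi.single b 1) : ℝ)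
        * (F (x, y) + (2 * ∑ v, μ0 v * s v - s (hub x) - s (hub y) + 2 * ∑ v, μ0 v * r v) - r a - r b)) := by
  have hq := hqc x y
  simp only [Matrix.mulVec, dotProduct, Fintype.sum_prod_type]
  have step1 : ∀ x' y', Q (x, y) (x', y') * Ψ (x', y') = ∑ a, ∑ b, q x y a b * (μ0 (hub x')
      * (if comp x' + Pi.single a 1 = comp x + Pi.single (hub x') 1 then (1 : ℝ) else 0))
      * ((if hub y' = hub x' then (1 : ℝ) else 0) * (if comp y' + Pi.single b 1 = comp y + Pi.single (hub y') 1 then (1 : ℝ) else 0)) * Ψ (x', y') := by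
    intro x' y'
    rw [hQ, Finset.sum_mul]
    exact sum_congr rfl fun a _ => by rw [Finset.sum_mul]
  simp_rw [step1]
  -- fold the summand and reorder `Σ_{x'} Σ_{y'} Σ_a Σ_b = Σ_a Σ_b Σ_{x'} Σ_{y'}`
  set T : X → X → S → S → ℝ := fun x' y' a b => q x y a b * (μ0 (hub x')
      * (if comp x' + Pi.single a 1 = comp x + Pi.single (hub x') 1 then (1 : ℝ) else 0))
      * ((if hub y' = hub x' then (1 : ℝ) else 0) * (if comp y' + Pi.single b 1 = comp y + Pi.single (hub y') 1 then (1 : ℝ) else 0)) * Ψ (x', y') with hTdef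
  have hfold : ∀ x' y' a b, q x y a b * (μ0 (hub x')
      * (if comp x' + Pi.single a 1 = comp x + Pi.single (hub x') 1 then (1 : ℝ) else 0))
      * ((if hub y' = hub x' then (1 : ℝ) else 0) * (if comp y' + Pi.single b 1 = comp y + Pi.single (hub y') 1 then (1 : ℝ) else 0)) * Ψ (x', y') = T x' y' a b :=
    fun _ _ _ _ => rfl
  simp_rw [hfold]
  have hre : ∑ x', ∑ y', ∑ a, ∑ b, T x' y' a b = ∑ a, ∑ b, ∑ x', ∑ y', T x' y' a b := by
    calc ∑ x', ∑ y', ∑ a, ∑ b, T x' y' a b = ∑ x', ∑ a, ∑ y', ∑ b, T x' y' a b := sum_congr rfl fun x' _ => Finset.sum_comm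
      _ = ∑ a, ∑ x', ∑ y', ∑ b, T x' y' a b := Finset.sum_comm
      _ = ∑ a, ∑ x', ∑ b, ∑ y', T x' y' a b := sum_congr rfl fun a _ => sum_congr rfl fun x' _ => Finset.sum_comm
      _ = ∑ a, ∑ b, ∑ x', ∑ y', T x' y' a b := sum_congr rfl fun a _ => Finset.sum_comm
  rw [hre]
  simp only [hTdef]
  refine sum_congr rfl fun a _ => sum_congr rfl fun b _ => ?_
  by_cases hqab : q x y a b = 0
  · simp [hqab]
  obtain ⟨hxa, hyb⟩ := urnChain_support hq hqab
  have hMx := lumped_survivor hlegal hxa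
  have hMy := lumped_survivor hlegal hyb
  -- the sum over `y'` for fixed `x'`: unique `y'` with `hub y' = hub x'`, `comp y' = M_y + δ_(hub x')`
  have hy : ∀ x', ∑ y', q x y a b * (μ0 (hub x')
      * (if comp x' + Pi.single a 1 = comp x + Pi.single (hub x') 1 then (1 : ℝ) else 0))
      * ((if hub y' = hub x' then (1 : ℝ) else 0) * (if comp y' + Pi.single b 1 = comp y + Pi.single (hub y') 1 then (1 : ℝ) else 0)) * Ψ (x', y')
      = q x y a b * (μ0 (hub x') * (if comp x' + Pi.single a 1 = comp x + Pi.single (hub x') 1 then (1 : ℝ) else 0))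
        * ((Δ (comp x') (comp y - Pi.single b 1 + Pi.single (hub x') 1) : ℝ)
          * (c + s (hub x') + s (hub x') + ∑ v, r v * ((comp x' v : ℝ) + ((comp y - Pi.single b 1 + Pi.single (hub x') 1 : S → ℕ) v : ℝ)))) := by
    intro x'
    have h := lumped_target_unique (μ0 := fun z => if z = hub x' then (1 : ℝ) else 0) hinj hsum hsurj hMy
      (fun z N => (Δ (comp x') N : ℝ) * (c + s (hub x') + s z + ∑ v, r v * ((comp x' v : ℝ) + (N v : ℝ))))
    simp only [ite_mul, one_mul, zero_mul, Finset.sum_ite_eq', mem_univ, if_true] at h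
    rw [← h, Finset.mul_sum]
    refine sum_congr rfl fun y' _ => ?_
    rw [hΨ, hF x' y']
    by_cases h1 : hub y' = hub x'
    · simp only [h1, if_true, mul_zero, add_zero]
      split_ifs <;> ring
    · simp only [if_neg h1, zero_mul, mul_zero]
  simp_rw [hy]
  -- the sum over `x'`: `Σ_{x'} μ0(hub x')𝟙{x'-cond} g(hub x', comp x') = Σ_z μ0(z) g(z, M_x + δ_z)`
  have h := lumped_target_unique (μ0 := μ0) hinj hsum hsurj hMx
    (fun z N => (Δ N (comp y - Pi.single b 1 + Pi.single z 1) : ℝ) * (c + s z + s z + ∑ v, r v * ((N v : ℝ) + ((comp y - Pi.single b 1 + Pi.single z 1 : S → ℕ) v : ℝ))))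
  have h' : ∑ x', q x y a b * (μ0 (hub x') * (if comp x' + Pi.single a 1 = comp x + Pi.single (hub x') 1 then (1 : ℝ) else 0))
        * ((Δ (comp x') (comp y - Pi.single b 1 + Pi.single (hub x') 1) : ℝ)
          * (c + s (hub x') + s (hub x') + ∑ v, r v * ((comp x' v : ℝ) + ((comp y - Pi.single b 1 + Pi.single (hub x') 1 : S → ℕ) v : ℝ))))
      = q x y a b * ∑ x', μ0 (hub x') * (if comp x' + Pi.single a 1 = comp x + Pi.single (hub x') 1 then
          (Δ (comp x') (comp y - Pi.single b 1 + Pi.single (hub x') 1) : ℝ)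
          * (c + s (hub x') + s (hub x') + ∑ v, r v * ((comp x' v : ℝ) + ((comp y - Pi.single b 1 + Pi.single (hub x') 1 : S → ℕ) v : ℝ))) else 0) := by
    rw [Finset.mul_sum]
    refine sum_congr rfl fun x' _ => ?_
    split_ifs <;> ring
  rw [h', h]
  -- evaluate `Δ` and the masses at the targets
  have hmass : ∀ z, ∑ v, r v * (((comp x - Pi.single a 1 + Pi.single z 1 : S → ℕ) v : ℝ) + ((comp y - Pi.single b 1 + Pi.single z 1 : S → ℕ) v : ℝ))
      = ∑ v, r v * ((comp x v : ℝ) + (comp y v : ℝ)) - r a - r b + 2 * r z := by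
    intro z
    have e1 := urnChain_mass_add_single (θ := r) (comp x - Pi.single a 1) z
    have e2 := urnChain_mass_add_single (θ := r) (comp y - Pi.single b 1) z
    have e3 := urnChain_mass_add_single (θ := r) (comp x - Pi.single a 1) a
    have e4 := urnChain_mass_add_single (θ := r) (comp y - Pi.single b 1) b
    rw [← hMx] at e3; rw [← hMy] at e4
    simp only [mul_add, sum_add_distrib] at e1 e2 e3 e4 ⊢
    rw [e1, e2]
    linarith
  have hterm : ∀ z, μ0 z * ((Δ (comp x - Pi.single a 1 + Pi.single z 1) (comp y - Pi.single b 1 + Pi.single z 1) : ℝ)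
        * (c + s z + s z + ∑ v, r v * (((comp x - Pi.single a 1 + Pi.single z 1 : S → ℕ) v : ℝ) + ((comp y - Pi.single b 1 + Pi.single z 1 : S → ℕ) v : ℝ))))
      = μ0 z * ((Δ (comp x - Pi.single a 1) (comp y - Pi.single b 1) : ℝ) * (c + ∑ v, r v * ((comp x v : ℝ) + (comp y v : ℝ)) - r a - r b))
        + (μ0 z * s z) * (2 * (Δ (comp x - Pi.single a 1) (comp y - Pi.single b 1) : ℝ))
        + (μ0 z * r z) * (2 * (Δ (comp x - Pi.single a 1) (comp y - Pi.single b 1) : ℝ)) := by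
    intro z
    rw [cdist_add_single_same hΔ, hmass z]; ring
  simp_rw [hterm]
  rw [sum_add_distrib, sum_add_distrib, ← Finset.sum_mul, ← Finset.sum_mul, ← Finset.sum_mul, hμ1, one_mul, hF]
  ring

omit [DecidableEq X] in
/-- **CONTRACTION FROM THE EQUAL-HUB CRITERION:** if for every pair with `hub x = hub y` the end-hub laws satisfy
`Σ_{a,b} q(a,b)Δ(M^a_x,M^b_y)(F + e − r_a − r_b) ≤ (1−ρ)·Δ(comp x,comp y)·F(x,y)`, and for every pair the same quantity is at most `B` with `B ≤ (1−ρ)C`, then `Q·Ψ ≤ (1−ρ)·Ψ`. [ours] -/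
theorem lumpedAny_contract (hinj : ∀ x x', hub x = hub x' → comp x = comp x' → x = x') (hsum : ∀ x, ∑ v, comp x v = K + 1)
    (hsurj : ∀ (z : S) (N : S → ℕ), ∑ v, N v = K + 1 → N z ≠ 0 → ∃ x, hub x = z ∧ comp x = N)
    (hμ1 : ∑ v, μ0 v = 1) (hlegal : ∀ x a, u x a ≠ 0 → comp x a ≠ 0)
    (hqc : ∀ x y, IsCoupling (u x) (u y) (q x y))
    (hΔ : ∀ N N', Δ N N' = ∑ v, (N v - N' v))
    (hQ : ∀ x y x' y', Q (x, y) (x', y') = ∑ a, ∑ b, q x y a b * (μ0 (hub x')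
      * (if comp x' + Pi.single a 1 = comp x + Pi.single (hub x') 1 then (1 : ℝ) else 0))
      * ((if hub y' = hub x' then (1 : ℝ) else 0) * (if comp y' + Pi.single b 1 = comp y + Pi.single (hub y') 1 then (1 : ℝ) else 0)))
    (hF : ∀ x y, F (x, y) = c + s (hub x) + s (hub y) + ∑ v, r v * ((comp x v : ℝ) + (comp y v : ℝ)))
    (hΨ : ∀ x y, Ψ (x, y) = (Δ (comp x) (comp y) : ℝ) * F (x, y) + C * (if hub x = hub y then (0 : ℝ) else 1))
    (hF0 : ∀ x y, 0 ≤ F (x, y)) {B : ℝ} (hρ1 : ρ ≤ 1) (hBC : B ≤ (1 - ρ) * C)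
    (hB : ∀ x y, ∑ a, ∑ b, q x y a b * ((Δ (comp x - Pi.single a 1) (comp y - Pi.single b 1) : ℝ)
        * (F (x, y) + (2 * ∑ v, μ0 v * s v - s (hub x) - s (hub y) + 2 * ∑ v, μ0 v * r v) - r a - r b)) ≤ B)
    (hcrit : ∀ x y, hub x = hub y → ∑ a, ∑ b, q x y a b * ((Δ (comp x - Pi.single a 1) (comp y - Pi.single b 1) : ℝ)
        * (F (x, y) + (2 * ∑ v, μ0 v * s v - s (hub x) - s (hub y) + 2 * ∑ v, μ0 v * r v) - r a - r b))
        ≤ (1 - ρ) * ((Δ (comp x) (comp y) : ℝ) * F (x, y))) (xy : X × X) :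
    (Q *ᵥ Ψ) xy ≤ (1 - ρ) * Ψ xy := by
  obtain ⟨x, y⟩ := xy
  rw [lumpedAny_mulVec_potential hinj hsum hsurj hμ1 hlegal hqc hΔ hQ hF hΨ x y, hΨ]
  by_cases hh : hub x = hub y
  · rw [if_pos hh, mul_zero, add_zero]; exact hcrit x y hh
  · rw [if_neg hh, mul_one]
    have hΔF : 0 ≤ (Δ (comp x) (comp y) : ℝ) * F (x, y) := mul_nonneg (Nat.cast_nonneg _) (hF0 x y)
    calc _ ≤ B := hB x y
      _ ≤ (1 - ρ) * C := hBC
      _ ≤ (1 - ρ) * ((Δ (comp x) (comp y) : ℝ) * F (x, y) + C) := by nlinarith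

/-- **THE LAW OF THE LUMPED CYCLE CHAIN FROM THE EQUAL-HUB CRITERION:** under the hypotheses of `lumpedAny_contract`, with `1 ≤ F ≤ F_max` and `C ≥ 1`, for any stationary `π`:
`d(n) ≤ ((K+1)·F_max + C)·(1−ρ)ⁿ`. [ours] -/
theorem lumpedAny_worstTvDist_le [Nonempty X] (hinj : ∀ x x', hub x = hub x' → comp x = comp x' → x = x') (hsum : ∀ x, ∑ v, comp x v = K + 1)
    (hsurj : ∀ (z : S) (N : S → ℕ), ∑ v, N v = K + 1 → N z ≠ 0 → ∃ x, hub x = z ∧ comp x = N)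
    (hμ0 : ∀ v, 0 ≤ μ0 v) (hμ1 : ∑ v, μ0 v = 1) (hlegal : ∀ x a, u x a ≠ 0 → comp x a ≠ 0)
    (hqc : ∀ x y, IsCoupling (u x) (u y) (q x y))
    (hΔ : ∀ N N', Δ N N' = ∑ v, (N v - N' v))
    (hP : ∀ x x', P x x' = ∑ a, u x a * (μ0 (hub x') * (if comp x' + Pi.single a 1 = comp x + Pi.single (hub x') 1 then (1 : ℝ) else 0)))
    (hQ : ∀ x y x' y', Q (x, y) (x', y') = ∑ a, ∑ b, q x y a b * (μ0 (hub x')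
      * (if comp x' + Pi.single a 1 = comp x + Pi.single (hub x') 1 then (1 : ℝ) else 0))
      * ((if hub y' = hub x' then (1 : ℝ) else 0) * (if comp y' + Pi.single b 1 = comp y + Pi.single (hub y') 1 then (1 : ℝ) else 0)))
    (hF : ∀ x y, F (x, y) = c + s (hub x) + s (hub y) + ∑ v, r v * ((comp x v : ℝ) + (comp y v : ℝ)))
    (hΨ : ∀ x y, Ψ (x, y) = (Δ (comp x) (comp y) : ℝ) * F (x, y) + C * (if hub x = hub y then (0 : ℝ) else 1))
    (hF1 : ∀ x y, 1 ≤ F (x, y)) (hFmax : ∀ x y, F (x, y) ≤ Fmax) (hC1 : 1 ≤ C) {B : ℝ} (hρ1 : ρ ≤ 1) (hBC : B ≤ (1 - ρ) * C)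
    (hB : ∀ x y, ∑ a, ∑ b, q x y a b * ((Δ (comp x - Pi.single a 1) (comp y - Pi.single b 1) : ℝ)
        * (F (x, y) + (2 * ∑ v, μ0 v * s v - s (hub x) - s (hub y) + 2 * ∑ v, μ0 v * r v) - r a - r b)) ≤ B)
    (hcrit : ∀ x y, hub x = hub y → ∑ a, ∑ b, q x y a b * ((Δ (comp x - Pi.single a 1) (comp y - Pi.single b 1) : ℝ)
        * (F (x, y) + (2 * ∑ v, μ0 v * s v - s (hub x) - s (hub y) + 2 * ∑ v, μ0 v * r v) - r a - r b))
        ≤ (1 - ρ) * ((Δ (comp x) (comp y) : ℝ) * F (x, y)))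
    {π : X → ℝ} (hπ : IsStationary π P) (hπ0 : ∀ x, 0 ≤ π x) (hπ1 : ∑ x, π x = 1) (n : ℕ) :
    worstTvDist P π n ≤ ((K + 1) * Fmax + C) * (1 - ρ) ^ n := by
  have hQc := lumpedAny_isMarkovianCoupling hinj hsum hsurj hμ0 hlegal hqc hP hQ
  have hF0 : ∀ x y, 0 ≤ F (x, y) := fun x y => zero_le_one.trans (hF1 x y)
  have hcontr := lumpedAny_contract hinj hsum hsurj hμ1 hlegal hqc hΔ hQ hF hΨ hF0 hρ1 hBC hB hcrit
  have hQ0 : ∀ z z' : X × X, 0 ≤ Q z z' := fun z z' => by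
    obtain ⟨x, y⟩ := z; obtain ⟨x', y'⟩ := z'
    exact (hQc x y).1 x' y'
  -- bounds on `Ψ`
  have hΨ0 : ∀ x y, 0 ≤ Ψ (x, y) := fun x y => by
    rw [hΨ]; exact add_nonneg (mul_nonneg (Nat.cast_nonneg _) (hF0 x y)) (mul_nonneg (zero_le_one.trans hC1) (by split_ifs <;> norm_num))
  have hΨ1 : ∀ x y, x ≠ y → 1 ≤ Ψ (x, y) := fun x y hxy => by
    rw [hΨ]
    by_cases hh : hub x = hub y
    · rw [if_pos hh, mul_zero, add_zero]
      have hne : comp x ≠ comp y := fun h => hxy (hinj x y hh h)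
      have hΔ1 : (1 : ℝ) ≤ (Δ (comp x) (comp y) : ℝ) := by
        have : Δ (comp x) (comp y) ≠ 0 := fun h0 => hne (eq_of_cdist_eq_zero hΔ (by rw [hsum x, hsum y]) h0)
        exact_mod_cast Nat.one_le_iff_ne_zero.mpr this
      nlinarith [hF1 x y]
    · rw [if_neg hh, mul_one]
      nlinarith [mul_nonneg (Nat.cast_nonneg (Δ (comp x) (comp y)) : (0 : ℝ) ≤ _) (hF0 x y)]
  have hΨmax : ∀ x y, Ψ (x, y) ≤ (K + 1) * Fmax + C := fun x y => by
    rw [hΨ]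
    have hΔle : (Δ (comp x) (comp y) : ℝ) ≤ K + 1 := by
      have := cdist_le_sum hΔ (comp x) (comp y); rw [hsum x] at this; exact_mod_cast this
    have h1 : (Δ (comp x) (comp y) : ℝ) * F (x, y) ≤ (K + 1) * Fmax :=
      mul_le_mul hΔle (hFmax x y) (hF0 x y) (by positivity)
    have h2 : C * (if hub x = hub y then (0 : ℝ) else 1) ≤ C := by
      split_ifs
      · rw [mul_zero]; exact zero_le_one.trans hC1
      · rw [mul_one]
    linarith
  refine LevinPeres2017_cor_5_5 hπ hπ0 hπ1 fun x0 y0 => ⟨Q, hQc, ?_⟩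
  set ind : X × X → ℝ := fun ab => if ab.1 = ab.2 then (0 : ℝ) else 1 with hind
  have hoff : ∑ a, ∑ b ∈ univ.erase a, kernelAt Q n (x0, y0) (a, b) = ((Q ^ n) *ᵥ ind) (x0, y0) := by
    simp only [Matrix.mulVec, dotProduct, Fintype.sum_prod_type]
    refine sum_congr rfl fun a _ => ?_
    have hdiag : (fun b => (Q ^ n) (x0, y0) (a, b) * ind (a, b)) a = 0 := by simp [hind]
    have hsplit : ∑ b, (Q ^ n) (x0, y0) (a, b) * ind (a, b) = ∑ b ∈ univ.erase a, (Q ^ n) (x0, y0) (a, b) * ind (a, b) :=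
      (Finset.sum_erase (f := fun b => (Q ^ n) (x0, y0) (a, b) * ind (a, b)) univ hdiag).symm
    rw [hsplit]
    refine sum_congr rfl fun b hb => ?_
    have hab : a ≠ b := (ne_of_mem_erase hb).symm
    rw [kernelAt_eq_pow_apply, hind]
    simp [hab]
  rw [hoff]
  have hind_le : ∀ ab : X × X, ind ab ≤ Ψ ab := by
    rintro ⟨a, b⟩
    by_cases hab : a = b
    · rw [hind]; simp only [hab, if_true]; exact hΨ0 b b
    · rw [hind]; simp only [if_neg hab]; exact hΨ1 a b hab
  calc ((Q ^ n) *ᵥ ind) (x0, y0) ≤ ((Q ^ n) *ᵥ Ψ) (x0, y0) := urnChain_pow_mono hQ0 hind_le n (x0, y0)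
    _ ≤ (1 - ρ) ^ n * Ψ (x0, y0) := urnChain_geometric hQ0 hρ1 hcontr n (x0, y0)
    _ ≤ (1 - ρ) ^ n * ((K + 1) * Fmax + C) := mul_le_mul_of_nonneg_left (hΨmax x0 y0) (pow_nonneg (by linarith) n)
    _ = ((K + 1) * Fmax + C) * (1 - ρ) ^ n := by ring

end LumpedAny

end Summit.Ventures.LatticeQCDFlow.Scaling
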